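import Literature.NumberTheory.LFunctions.RobinTFreeMertens
import Literature.NumberTheory.LFunctions.ChebyshevThetaSqrtBounds
import Mathlib.Analysis.SpecialFunctions.ImproperIntegrals
import HarnessLib

/-!
# Explicit bounds for the Mertens remainder `E(x)` from Büthe's and BKLNW's `θ`-bounds

Cell topic `Summits/Ventures/RobinTFree` (rh-explicit ROBIN track; new estimates, not a published statement). Pure proof file. Under the two named facts
`Buthe2018_thm2_theta` (`0.05√t < t − θ(t) ≤ 1.95√t` on `[1423, 10¹⁹]`) and
`BroadbentEtAl2021_theta_rel_1e19` (`|θ(t) − t| < 3.79·10⁻⁵ t/log²t` for `t ≥ 10¹⁹`; both in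
`ChebyshevThetaSqrtBounds.lean`) — the latter used only through the
parametrised shape `ThetaRelBound c : |θ(t) − t| < c·t/log²t (t ≥ 10¹⁹)`, so that the table constant
`3.7979·10⁻⁵` or any `c ≤ 4·10⁻⁵` can be substituted — we bound
Rosser–Schoenfeld's remainder `E(x) = (θ(x) − x)/(x log x) − ∫_x^∞ (θ(t) − t) w(t) dt`
(`mertensRemainder`, `w(t) = (1 + log t)/(t² log² t)`):

* `integrableOn_theta_sub_mul_weight_Ioi` : `(θ − id)·w` is integrable on `(x, ∞)` for `x ≥ 1423`;
* `mertensRemainder_le_E1` : for `1423 ≤ x ≤ 10¹⁹`,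
  `E(x) ≤ −0.05/(√x log x) + 3.9 (1 + log x)/(√x log² x) + K`, `K = c (1/(2L²) + 1/(3L³))`,
  `L = log 10¹⁹` (Büthe on `(x, 10¹⁹]` with `(1+log t)/log²t ≤ (1+log x)/log²x` and `∫_x^∞ t^{-3/2} = 2/√x`;
  BKLNW beyond, integrated exactly);
* `mertensRemainder_le_E2` : for `x ≥ 10¹⁹`, `E(x) ≤ 3.79·10⁻⁵ (4/(3 log³x) + 1/(2 log²x))`.

These are the analytic estimates of Morrill–Platt 2021 (Lemmas 4–5) with Büthe 2018 / BKLNW 2021 in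
place of Schoenfeld 1976 / Dusart 2018 as inputs.

## References
* J. B. Rosser, L. Schoenfeld, Illinois J. Math. 6 (1962), (4.20). [RosserSchoenfeld1962]
* T. Morrill, D. Platt, Integers 21 (2021) A28, Lemmas 4–5. [MorrillPlatt2021]
* J. Büthe, Math. Comp. 87 (2018), Thm 2. [Buthe2018]
* S. Broadbent et al., Math. Comp. 90 (2021), §1.2. [BKLNW2021]
-/

noncomputable section

open Real Filter Topology Set MeasureTheory
open scoped Chebyshev

namespace Summit.Ventures.RobinTFree

open Literature.NumberTheory.LFunctions Literature.NumberTheory.LFunctions.RobinTFree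

/-- The BKLNW tail constant `K(L) = 3.79·10⁻⁵ (1/(2L²) + 1/(3L³))` (value of
`∫_X^∞ 3.79·10⁻⁵ (1+log t)/(t log⁴ t) dt` at `L = log X`). [folklore] -/
def bklnwTail (c L : ℝ) : ℝ := c * (1 / (2 * L ^ 2) + 1 / (3 * L ^ 3))

/-- The shape of the BKLNW input: `|θ(x) − x| < c · x/log²x` for all `x ≥ 10¹⁹`. [folklore] -/
def ThetaRelBound (c : ℝ) : Prop := ∀ x : ℝ, (10 : ℝ) ^ 19 ≤ x → |θ x - x| < c * x / Real.log x ^ 2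

/-- BKLNW's display constant: `BroadbentEtAl2021_theta_rel_1e19 → ThetaRelBound 3.79·10⁻⁵`.
[cite: BKLNW2021, §1.2 (display after Thm 1)] -/
theorem thetaRelBound_of_bklnw (h : BroadbentEtAl2021_theta_rel_1e19) : ThetaRelBound 3.79e-5 :=
  fun _ hx => h.abs_sub_lt hx

/-- The majorant `E1(x) = −0.05/(√x log x) + 3.9 (1 + log x)/(√x log² x) + K(log 10¹⁹)` of `E(x)` on
`[1423, 10¹⁹]`. [folklore] -/
def E1 (c x : ℝ) : ℝ :=
  -0.05 / (√x * Real.log x) + 3.9 * (1 + Real.log x) / (√x * Real.log x ^ 2) +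
    bklnwTail c (Real.log ((10 : ℝ) ^ 19))

/-- The majorant `E2(c, x) = c (4/(3 log³x) + 1/(2 log²x))` of `E(x)` on `[10¹⁹, ∞)`. [folklore] -/
def E2 (c x : ℝ) : ℝ := c * (4 / (3 * Real.log x ^ 3) + 1 / (2 * Real.log x ^ 2))

/-! ### Measurability and elementary properties of the weight -/

/-- The weight is measurable. [folklore] -/
theorem measurable_mertensWeight : Measurable mertensWeight := by
  unfold mertensWeight
  fun_prop

/-- `θ` is measurable (it factors through `⌊·⌋₊`). [folklore] -/
theorem measurable_theta : Measurable (fun x : ℝ => θ x) := by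
  have : (fun x : ℝ => θ x) = (fun n : ℕ => θ (n : ℝ)) ∘ Nat.floor := by
    funext x; simp [Chebyshev.theta_eq_theta_coe_floor x]
  rw [this]
  exact (measurable_from_nat (f := fun n : ℕ => θ (n : ℝ))).comp Nat.measurable_floor

/-- `(θ − id)·w` is integrable on bounded intervals `(x, y]`, `x > 1` (`θ` is monotone, hence
integrable on compacts; `w` is continuous there). [folklore] -/
theorem integrableOn_theta_sub_mul_weight_Ioc {x y : ℝ} (hx : 1 < x) :
    IntegrableOn (fun t => (θ t - t) * mertensWeight t) (Ioc x y) := by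
  by_cases hxy : x ≤ y
  swap
  · rw [Set.Ioc_eq_empty (by push Not at hxy; exact not_lt.mpr hxy.le)]; exact integrableOn_empty
  have hK : IsCompact (Set.Icc x y) := isCompact_Icc
  have hθ : IntegrableOn (fun t : ℝ => θ t - t) (Set.Icc x y) :=
    (Chebyshev.theta_mono.monotoneOn _).integrableOn_isCompact hK |>.sub
      (continuousOn_id.integrableOn_compact hK)
  have hsub : ∀ t ∈ Set.Icc x y, t ∈ ({0}ᶜ : Set ℝ) := fun t ht =>
    Set.mem_compl_singleton_iff.mpr (show (0:ℝ) < t by linarith [ht.1]).ne'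
  have h0 : ∀ t ∈ Set.Icc x y, t ^ 2 * Real.log t ^ 2 ≠ 0 := fun t ht =>
    mul_ne_zero (pow_ne_zero _ (by linarith [ht.1]))
      (pow_ne_zero _ (Real.log_pos (lt_of_lt_of_le hx ht.1)).ne')
  have hw : ContinuousOn mertensWeight (Set.Icc x y) := by
    unfold mertensWeight
    refine ContinuousOn.div ?_ ?_ h0
    · exact continuousOn_const.add (Real.continuousOn_log.mono hsub)
    · exact (continuousOn_pow 2).mul ((Real.continuousOn_log.mono hsub).pow 2)
  exact (hθ.mono_set Set.Ioc_subset_Icc_self).mul_continuousOn_of_subset hw measurableSet_Ioc hK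
    Set.Ioc_subset_Icc_self

/-- The weight is nonnegative for `t ≥ 1`. [folklore] -/
theorem mertensWeight_nonneg {t : ℝ} (ht : 1 ≤ t) : 0 ≤ mertensWeight t := by
  unfold mertensWeight
  have := Real.log_nonneg ht
  positivity

/-- `(1 + u)/u²` is antitone on `u > 0`. [folklore] -/
theorem one_add_div_sq_antitone {u v : ℝ} (hu : 0 < u) (huv : u ≤ v) :
    (1 + v) / v ^ 2 ≤ (1 + u) / u ^ 2 := by
  have hv : 0 < v := lt_of_lt_of_le hu huv
  rw [div_le_div_iff₀ (by positivity) (by positivity)]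
  nlinarith [mul_pos hu hv, sq_nonneg (v - u), mul_pos (mul_pos hu hv) hv]

/-- For `1 < x ≤ t`: `√t · w(t) ≤ (1 + log x)/log²x · t^{-3/2}`. [folklore] -/
theorem sqrt_mul_weight_le {x t : ℝ} (hx : 1 < x) (hxt : x ≤ t) :
    √t * mertensWeight t ≤ (1 + Real.log x) / Real.log x ^ 2 * t ^ (-(3:ℝ)/2) := by
  have ht : 0 < t := by linarith
  have hlx : 0 < Real.log x := Real.log_pos hx
  have hlt : Real.log x ≤ Real.log t := Real.log_le_log (by linarith) hxt
  have h1 : (1 + Real.log t) / Real.log t ^ 2 ≤ (1 + Real.log x) / Real.log x ^ 2 :=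
    one_add_div_sq_antitone hlx hlt
  have hw : √t * mertensWeight t = (1 + Real.log t) / Real.log t ^ 2 * t ^ (-(3:ℝ)/2) := by
    unfold mertensWeight
    have hs : √t = t ^ ((1:ℝ)/2) := Real.sqrt_eq_rpow t
    have h32 : t ^ (-(3:ℝ)/2) = t ^ ((1:ℝ)/2) / t ^ 2 := by
      rw [← Real.rpow_natCast t 2, ← Real.rpow_sub ht]; norm_num
    rw [hs, h32]
    have : (Real.log t) ^ 2 ≠ 0 := pow_ne_zero _ (by linarith : Real.log t ≠ 0) |>.symm |>.symm
    field_simp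
  rw [hw]
  exact mul_le_mul_of_nonneg_right h1 (by positivity)

/-! ### The BKLNW tail: integrability and exact value -/

/-- Antiderivative of `(1 + log t)/(t log⁴ t)`: `F(t) = −((log t)⁻² /2 + (log t)⁻³/3)`. [folklore] -/
theorem hasDerivAt_tailPrimitive {t : ℝ} (ht : 1 < t) :
    HasDerivAt (fun t => -(((Real.log t)⁻¹) ^ 2 / 2 + ((Real.log t)⁻¹) ^ 3 / 3))
      ((1 + Real.log t) / (t * Real.log t ^ 4)) t := by
  have ht0 : t ≠ 0 := by linarith
  have hl : Real.log t ≠ 0 := (Real.log_pos ht).ne'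
  have hu : HasDerivAt (fun t => (Real.log t)⁻¹) (-(t⁻¹) / (Real.log t) ^ 2) t :=
    (Real.hasDerivAt_log ht0).inv hl
  have h := (((hu.pow 2).div_const 2).add ((hu.pow 3).div_const 3)).neg
  refine h.congr_deriv ?_
  simp only [Nat.cast_ofNat, Nat.add_one_sub_one, pow_one, inv_pow]
  field_simp
  ring

/-- `∫_X^∞ (1 + log t)/(t log⁴ t) dt = 1/(2 log²X) + 1/(3 log³X)` for `X > 1`, with integrability.
[folklore] -/
theorem integral_tail_weight {X : ℝ} (hX : 1 < X) :
    IntegrableOn (fun t => (1 + Real.log t) / (t * Real.log t ^ 4)) (Ioi X) ∧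
    ∫ t in Ioi X, (1 + Real.log t) / (t * Real.log t ^ 4) =
      1 / (2 * Real.log X ^ 2) + 1 / (3 * Real.log X ^ 3) := by
  set F : ℝ → ℝ := fun t => -(((Real.log t)⁻¹) ^ 2 / 2 + ((Real.log t)⁻¹) ^ 3 / 3) with hF
  have hderiv : ∀ t ∈ Ioi X, HasDerivAt F ((1 + Real.log t) / (t * Real.log t ^ 4)) t :=
    fun t ht => hasDerivAt_tailPrimitive (lt_trans hX ht)
  have hcont : ContinuousWithinAt F (Ici X) X :=
    (hasDerivAt_tailPrimitive hX).continuousAt.continuousWithinAt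
  have hpos : ∀ t ∈ Ioi X, 0 ≤ (1 + Real.log t) / (t * Real.log t ^ 4) := fun t ht => by
    have : 1 < t := lt_trans hX ht
    have := Real.log_pos this
    positivity
  have hlim : Tendsto F atTop (𝓝 0) := by
    have hu : Tendsto (fun t => (Real.log t)⁻¹) atTop (𝓝 0) := Real.tendsto_log_atTop.inv_tendsto_atTop
    have h2 : Tendsto (fun t => ((Real.log t)⁻¹) ^ 2 / 2) atTop (𝓝 (0 ^ 2 / 2)) := (hu.pow 2).div_const 2
    have h3 : Tendsto (fun t => ((Real.log t)⁻¹) ^ 3 / 3) atTop (𝓝 (0 ^ 3 / 3)) := (hu.pow 3).div_const 3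
    have := (h2.add h3).neg
    simpa [hF] using this
  have hint : IntegrableOn (fun t => (1 + Real.log t) / (t * Real.log t ^ 4)) (Ioi X) :=
    integrableOn_Ioi_deriv_of_nonneg hcont hderiv hpos hlim
  refine ⟨hint, ?_⟩
  rw [integral_Ioi_of_hasDerivAt_of_tendsto hcont hderiv hint hlim, hF]
  have hl : Real.log X ≠ 0 := (Real.log_pos hX).ne'
  field_simp
  ring

/-! ### Integrability of `(θ − id)·w` on `(x, ∞)` under BKLNW -/

/-- Pointwise BKLNW majorant: for `t ≥ 10¹⁹`, `|(θ(t) − t) w(t)| ≤ 3.79·10⁻⁵ (1 + log t)/(t log⁴ t)`.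
[cite: BKLNW2021, §1.2 (display after Thm 1)] -/
theorem abs_theta_sub_mul_weight_le {c : ℝ} (hK : ThetaRelBound c) {t : ℝ} (ht : (10:ℝ) ^ 19 ≤ t) :
    |(θ t - t) * mertensWeight t| ≤ c * ((1 + Real.log t) / (t * Real.log t ^ 4)) := by
  have ht1 : 1 < t := lt_of_lt_of_le (by norm_num) ht
  have ht0 : 0 < t := by linarith
  have hl : 0 < Real.log t := Real.log_pos ht1
  have h := hK t ht
  rw [lt_div_iff₀ (by positivity)] at h
  -- `|θ t − t| · log²t < c · t`
  have hw : 0 ≤ mertensWeight t := mertensWeight_nonneg ht1.le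
  rw [abs_mul, abs_of_nonneg hw, mertensWeight]
  have : |θ t - t| * ((1 + Real.log t) / (t ^ 2 * Real.log t ^ 2)) =
      (|θ t - t| * Real.log t ^ 2) * ((1 + Real.log t) / (t ^ 2 * Real.log t ^ 4)) := by
    field_simp
  rw [this]
  have h2 : c * ((1 + Real.log t) / (t * Real.log t ^ 4)) =
      (c * t) * ((1 + Real.log t) / (t ^ 2 * Real.log t ^ 4)) := by
    field_simp
  rw [h2]
  exact mul_le_mul_of_nonneg_right h.le (by positivity)

/-- Under BKLNW's bound, `(θ − id)·w` is integrable on `(X, ∞)` for `X ≥ 10¹⁹`. [folklore] -/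
theorem integrableOn_theta_sub_mul_weight_Ioi_of_ge {c : ℝ} (hK : ThetaRelBound c) {X : ℝ}
    (hX : (10:ℝ) ^ 19 ≤ X) : IntegrableOn (fun t => (θ t - t) * mertensWeight t) (Ioi X) := by
  have hX1 : 1 < X := lt_of_lt_of_le (by norm_num) hX
  have hmaj := ((integral_tail_weight hX1).1.const_mul c)
  refine hmaj.mono' ?_ ?_
  · exact ((measurable_theta.sub measurable_id).mul measurable_mertensWeight).aestronglyMeasurable
  · refine (ae_restrict_mem measurableSet_Ioi).mono fun t ht => ?_
    rw [Real.norm_eq_abs]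
    exact abs_theta_sub_mul_weight_le hK (hX.trans (le_of_lt ht))

/-- Under BKLNW's bound, `(θ − id)·w` is integrable on `(x, ∞)` for every `x > 1`. [folklore] -/
theorem integrableOn_theta_sub_mul_weight_Ioi {c : ℝ} (hK : ThetaRelBound c) {x : ℝ} (hx : 1 < x) :
    IntegrableOn (fun t => (θ t - t) * mertensWeight t) (Ioi x) := by
  set X := max x ((10:ℝ) ^ 19) with hXdef
  have hxX : x ≤ X := le_max_left _ _
  have h1 := integrableOn_theta_sub_mul_weight_Ioc (y := X) hx
  have h2 := integrableOn_theta_sub_mul_weight_Ioi_of_ge hK (le_max_right x ((10:ℝ)^19))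
  have := h1.union h2
  rwa [Set.Ioc_union_Ioi_eq_Ioi hxX] at this

/-! ### The bound `E(x) ≤ E1(x)` on `[1423, 10¹⁹]` -/

/-- The BKLNW tail: `−∫_X^∞ (θ − t) w ≤ K(log X)` for `X ≥ 10¹⁹`. [folklore] -/
theorem neg_integral_Ioi_le_bklnwTail {c : ℝ} (hK : ThetaRelBound c) {X : ℝ} (hX : (10:ℝ) ^ 19 ≤ X) :
    -∫ t in Ioi X, (θ t - t) * mertensWeight t ≤ bklnwTail c (Real.log X) := by
  have hX1 : 1 < X := lt_of_lt_of_le (by norm_num) hX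
  obtain ⟨hint, hval⟩ := integral_tail_weight hX1
  have hg := integrableOn_theta_sub_mul_weight_Ioi_of_ge hK hX
  rw [← integral_neg, bklnwTail, show c * (1 / (2 * Real.log X ^ 2) + 1 / (3 * Real.log X ^ 3))
    = ∫ t in Ioi X, c * ((1 + Real.log t) / (t * Real.log t ^ 4)) by
      rw [integral_const_mul, hval]]
  refine setIntegral_mono_on hg.neg (hint.const_mul _) measurableSet_Ioi fun t ht => ?_
  have := abs_theta_sub_mul_weight_le hK (hX.trans (le_of_lt ht))
  have := neg_abs_le ((θ t - t) * mertensWeight t)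
  linarith

/-- The Büthe part: for `1423 ≤ x ≤ X ≤ 10¹⁹`, `−∫_x^X (θ − t) w ≤ 3.9 (1 + log x)/(√x log²x)`.
[cite: Buthe2018, Thm 2] -/
theorem neg_integral_Ioc_le (hB : Buthe2018_thm2_theta) {x X : ℝ} (hx : 1423 ≤ x)
    (hX : X ≤ (10:ℝ) ^ 19) :
    -∫ t in Ioc x X, (θ t - t) * mertensWeight t ≤
      3.9 * (1 + Real.log x) / (√x * Real.log x ^ 2) := by
  have hx1 : 1 < x := by linarith
  have hx0 : 0 < x := by linarith
  set C : ℝ := 1.95 * ((1 + Real.log x) / Real.log x ^ 2) with hC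
  have hCnn : 0 ≤ C := by have := Real.log_pos hx1; positivity
  have hg := integrableOn_theta_sub_mul_weight_Ioc (y := X) hx1
  -- pointwise: `−(θ t − t) w t ≤ C t^{-3/2}` on `(x, X]`
  have hpt : ∀ t ∈ Ioc x X, -((θ t - t) * mertensWeight t) ≤ C * t ^ (-(3:ℝ)/2) := by
    intro t ht
    have htx : x ≤ t := ht.1.le
    have ht1 : 1 ≤ t := by linarith
    have hB1 := hB.1 t (by linarith) (ht.2.trans hX)
    have hw := mertensWeight_nonneg ht1
    calc -((θ t - t) * mertensWeight t) = (t - θ t) * mertensWeight t := by ring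
      _ ≤ (1.95 * √t) * mertensWeight t := mul_le_mul_of_nonneg_right hB1 hw
      _ = 1.95 * (√t * mertensWeight t) := by ring
      _ ≤ 1.95 * ((1 + Real.log x) / Real.log x ^ 2 * t ^ (-(3:ℝ)/2)) :=
          mul_le_mul_of_nonneg_left (sqrt_mul_weight_le hx1 htx) (by norm_num)
      _ = C * t ^ (-(3:ℝ)/2) := by rw [hC]; ring
  have hrpow_int : IntegrableOn (fun t : ℝ => C * t ^ (-(3:ℝ)/2)) (Ioi x) :=
    (integrableOn_Ioi_rpow_of_lt (by norm_num) hx0).const_mul C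
  have h1 : -∫ t in Ioc x X, (θ t - t) * mertensWeight t ≤ ∫ t in Ioc x X, C * t ^ (-(3:ℝ)/2) := by
    rw [← integral_neg]
    exact setIntegral_mono_on hg.neg (hrpow_int.mono_set Ioc_subset_Ioi_self) measurableSet_Ioc hpt
  have h2 : ∫ t in Ioc x X, C * t ^ (-(3:ℝ)/2) ≤ ∫ t in Ioi x, C * t ^ (-(3:ℝ)/2) :=
    setIntegral_mono_set hrpow_int
      ((ae_restrict_mem measurableSet_Ioi).mono fun t ht => by
        have : 0 < t := hx0.trans ht
        positivity)
      (ae_of_all _ fun t ht => Ioc_subset_Ioi_self ht)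
  have h3 : ∫ t in Ioi x, C * t ^ (-(3:ℝ)/2) = C * (2 / √x) := by
    rw [integral_const_mul, integral_Ioi_rpow_of_lt (by norm_num) hx0]
    congr 1
    rw [show (-(3:ℝ)/2 + 1) = -((1:ℝ)/2) by norm_num, Real.rpow_neg hx0.le, ← Real.sqrt_eq_rpow]
    field_simp
  have hsx : 0 < √x := Real.sqrt_pos.mpr hx0
  have hlx : 0 < Real.log x := Real.log_pos hx1
  calc -∫ t in Ioc x X, (θ t - t) * mertensWeight t ≤ C * (2 / √x) := by linarith
    _ = 3.9 * (1 + Real.log x) / (√x * Real.log x ^ 2) := by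
      rw [hC]; field_simp; ring

/-- **The remainder bound on `[1423, 10¹⁹]`** (Büthe on `(x, 10¹⁹]`, BKLNW beyond, and the sign
`θ(x) < x − 0.05√x`): `E(x) ≤ E1(x)`. [cite: MorrillPlatt2021, Lemma 5 (method)] -/
theorem mertensRemainder_le_E1 (hB : Buthe2018_thm2_theta) {c : ℝ} (hK : ThetaRelBound c)
    {x : ℝ} (hx : 1423 ≤ x) (hxX : x ≤ (10:ℝ) ^ 19) : mertensRemainder x ≤ E1 c x := by
  have hx1 : 1 < x := by linarith
  have hx0 : 0 < x := by linarith
  have hsx : 0 < √x := Real.sqrt_pos.mpr hx0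
  have hlx : 0 < Real.log x := Real.log_pos hx1
  set X : ℝ := (10:ℝ) ^ 19 with hXdef
  -- first term
  have hfirst : (θ x - x) / (x * Real.log x) ≤ -0.05 / (√x * Real.log x) := by
    have hb := hB.2 x (by linarith) hxX
    have : (θ x - x) / (x * Real.log x) ≤ (-(0.05 * √x)) / (x * Real.log x) :=
      div_le_div_of_nonneg_right (by linarith) (by positivity)
    refine this.trans_eq ?_
    rw [show x * Real.log x = √x * (√x * Real.log x) by
      rw [← mul_assoc, Real.mul_self_sqrt hx0.le]]
    field_simp
  -- split the integral at `X`
  have hg1 := integrableOn_theta_sub_mul_weight_Ioc (y := X) hx1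
  have hg2 := integrableOn_theta_sub_mul_weight_Ioi_of_ge hK (le_refl X)
  have hsplit : ∫ t in Ioi x, (θ t - t) * mertensWeight t =
      (∫ t in Ioc x X, (θ t - t) * mertensWeight t) + ∫ t in Ioi X, (θ t - t) * mertensWeight t := by
    rw [← setIntegral_union (Set.Ioc_disjoint_Ioi le_rfl) measurableSet_Ioi hg1 hg2,
      Set.Ioc_union_Ioi_eq_Ioi hxX]
  have hI1 := neg_integral_Ioc_le hB hx (le_refl X)
  have hI2 := neg_integral_Ioi_le_bklnwTail hK (le_refl X)
  simp only [hXdef] at hI1 hI2 hsplit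
  have h := add_le_add (add_le_add hfirst hI1) hI2
  unfold mertensRemainder E1
  rw [hsplit]
  calc (θ x - x) / (x * Real.log x) -
        ((∫ t in Ioc x ((10:ℝ) ^ 19), (θ t - t) * mertensWeight t) +
          ∫ t in Ioi ((10:ℝ) ^ 19), (θ t - t) * mertensWeight t)
      = (θ x - x) / (x * Real.log x) + -(∫ t in Ioc x ((10:ℝ) ^ 19), (θ t - t) * mertensWeight t) +
          -(∫ t in Ioi ((10:ℝ) ^ 19), (θ t - t) * mertensWeight t) := by ring
    _ ≤ -0.05 / (√x * Real.log x) + 3.9 * (1 + Real.log x) / (√x * Real.log x ^ 2) +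
          bklnwTail c (Real.log ((10:ℝ) ^ 19)) := h

/-! ### The bound `E(x) ≤ E2(x)` on `[10¹⁹, ∞)` -/

/-- **The remainder bound beyond `10¹⁹`** (BKLNW only): `E(x) ≤ E2(x)`.
[cite: BKLNW2021, §1.2 (display after Thm 1)] -/
theorem mertensRemainder_le_E2 {c : ℝ} (hK : ThetaRelBound c) {x : ℝ} (hx : (10:ℝ) ^ 19 ≤ x) :
    mertensRemainder x ≤ E2 c x := by
  have hx1 : 1 < x := lt_of_lt_of_le (by norm_num) hx
  have hx0 : 0 < x := by linarith
  have hlx : 0 < Real.log x := Real.log_pos hx1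
  have hfirst : (θ x - x) / (x * Real.log x) ≤ c / Real.log x ^ 3 := by
    have h := hK x hx
    have habs : (θ x - x) / (x * Real.log x) ≤ |θ x - x| / (x * Real.log x) :=
      div_le_div_of_nonneg_right (le_abs_self _) (by positivity)
    refine habs.trans ?_
    rw [div_le_iff₀ (by positivity)]
    calc |θ x - x| ≤ c * x / Real.log x ^ 2 := h.le
      _ = c / Real.log x ^ 3 * (x * Real.log x) := by field_simp
  have hI := neg_integral_Ioi_le_bklnwTail hK hx
  unfold mertensRemainder E2
  unfold bklnwTail at hI
  have : c * (4 / (3 * Real.log x ^ 3) + 1 / (2 * Real.log x ^ 2)) =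
      c / Real.log x ^ 3 + c * (1 / (2 * Real.log x ^ 2) + 1 / (3 * Real.log x ^ 3)) := by
    field_simp; ring
  rw [this]
  linarith

end Summit.Ventures.RobinTFree
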